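import Literature.IUT.HodgeArakelov.AbsTopMonoidsGenuineOfSettingTempered
import Literature.IUT.HodgeArakelov.MonoThetaProjectiveBridgeEtTh
import HarnessLib

/-!
# (H1)/(H2) TOKENS at abc-iut-w4-d030's level settings `EtaleLevels.levelSetting M` / `EtaleLevels.setting` of `X̲̲_K`
# — the binders `hΔ`, `hq` of the Cor 1.11 / Cor 1.12 (iii) / Prop 1.5 model theorems, from η′ + ONE regime package

S. Mochizuki, *Inter-universal Teichmüller theory II*, §1, Example 1.8 (i) (kurims p. 35), Cor. 1.11 (p. 49), Cor. 1.12 (iii)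
(p. 58) [claim: Mochizuki2012, status: disputed]; [SemiAnbd] Ex. 3.10 p. 43 [cite: MochizukiSemiAnbd2006, Ex 3.10 p.43].

PROOF-ONLY sequel (abc-iut cell, seat abc-iut-w5-d233 gen 4; theorems only, no definitions) of
`AbsTopMonoidsGenuineOfSettingTempered.lean` (p437556).  The [IUTchII] §1 settings used by the genuine-chain files of Cor. 1.11
(abc-iut-w4-d030 p431925, this lineage's own-field form p433665, abc-iut-w5-d145 p434854) and Cor. 1.12 (iii) (abc-iut-w4-d043,
own-field form p434852) are abc-iut-w4-d030's `EtaleLevels.levelSetting … M` / `EtaleLevels.setting …` :=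
`ThetaSetting.ofDoubleUnderline C (mods M) hC hS hl hp2 hpl hζ (eta0_mem … M)` (level `M`, resp. `M = 1`) — DEFINITIONALLY the
genuine setting of p429527 / p437556.  Those theorems carry the two binders

  (H1) `hΔ : ∀ φ : Π^tp_{X̲̲} ≃ₜ* Π^tp_{X̲̲}, φ(Δ^tp_{X̲̲}) = Δ^tp_{X̲̲}`   and   (H2) `hq : Nonempty (Π^tp_{X̲̲}/Δ^tp_{X̲̲} ≃ₜ* G_K)`.

This file supplies them AT `levelSetting M` / `setting` BY NAME (one `exact` each, by unfolding to `ofDoubleUnderline`):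
* `EtaleLevels.quotDeltaX_iso_levelSetting_of_isTempered` / `…_setting_of_isTempered` / `…_of_groupLevelData` — **(H2) from
  «`Π^tp_X` tempered, Galois-countable»** (η′ parameters; open mapping theorem for tempered groups, p416385 → p437556);
* `EtaleLevels.isOpenMap_aug_levelSetting_of_isTempered` — the augmentation of the level setting is open;
* `EtaleLevels.exists_completion_package_levelSetting` / `…_setting` — the compatible MLF completion package EXISTS (p429527);
* `EtaleLevels.deltaX_characteristic_levelSetting_of_exists_package` / `…_setting_…` — **(H1) from ONE compatible completion
  package in the [AbsTopI] Thm 2.6 (v) regime** (`Δ_E` tfg + `CoinvariantRankConstant`, FACT-LIST F-0001 at that named instance);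
* `EtaleLevels.nonempty_absTopMonoids_levelSetting_of_isTempered` — the Ex 1.8 interface inhabited at every level setting modulo
  {η′, regime package}.
So the residual named inputs «(H1) `hΔ`, (H2) `hq`» recorded on NODES IUTchII:Cor1.11 / Cor1.12(iii) read: (H2) ⟸ η′ parameters of
`Π^tp_X`; (H1) ⟸ ONE regime package (F-0001 + `Δ` tfg on a package whose existence is proved) — consumers substitute
`hq := quotDeltaX_iso_setting_of_isTempered … hT`, `hΔ := deltaX_characteristic_setting_of_exists_package … h`.

HONEST SCOPE: kernel plumbing; the regime package is a FACT-LIST input BY NAME; «tempered + Galois-countable» are interface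
parameters of the genuine `Π^tp_X`; no curve / theta setting asserted to exist; nothing here bears on [IUTchIII] Cor. 3.12; no
side is taken; typed ≠ proved elsewhere.
-/

noncomputable section

namespace Literature.IUT.HodgeArakelov

open Literature.AnabelianGeometry.AbsoluteAnabelian
open Literature.AnabelianGeometry.EtaleTheta Literature.AnabelianGeometry.SemiGraphs
open scoped Literature.AnabelianGeometry.EtaleTheta

namespace EtaleLevels

variable {p : ℕ} [Fact p.Prime] {D : Literature.AnabelianGeometry.EtaleTheta.ThetaSetting p}
  {E : D.EtaleThetaData} {l : ℕ} (C : E.DoubleUnderline l) (hC : D.Compat) (hS : D.Sec2Hyps)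
  (hl : l.Prime) (hp2 : p ≠ 2) (hpl : p ≠ l) (hζ : ∃ ζ : D.K, IsPrimitiveRoot ζ (4 * l))
  (mods : ∀ M : ℕ+, D.CyclotomeMod l M)
  (f : contCocycles D.toTheta D.DeltaTheta C.GtpYdduu) (hf : f ∈ C.rootCocycles hC)

/-! ### (H2) at the level settings from temperedness -/

/-- The augmentation `Π^tp_{X̲̲} ↠ G_K` of the level-`M` setting is OPEN for tempered Galois-countable `Π^tp_X`.
[cite: MochizukiSemiAnbd2006, Ex 3.10 p.43] -/
theorem isOpenMap_aug_levelSetting_of_isTempered (hT : IsTempered D.PiTemp) [FirstCountableTopology D.PiTemp] (M : ℕ+) :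
    IsOpenMap (levelSetting C hC hS hl hp2 hpl hζ mods f hf M).aug :=
  ThetaSetting.isOpenMap_aug_ofDoubleUnderline_of_isTempered C (mods M) hC hS hl hp2 hpl hζ
    (eta0_mem C hC hS mods f hf M) hT

/-- **(H2) at the level-`M` setting from temperedness**: `Π^tp_{X̲̲}/Δ^tp_{X̲̲} ⥲ G_K` as topological groups.
[claim: Mochizuki2012, status: disputed] (IUTchII §1 Ex 1.8 (i), kurims p.35) [cite: MochizukiSemiAnbd2006, Ex 3.10 p.43] -/
theorem quotDeltaX_iso_levelSetting_of_isTempered (hT : IsTempered D.PiTemp) [FirstCountableTopology D.PiTemp] (M : ℕ+) :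
    Nonempty (TopGroup.quot (levelSetting C hC hS hl hp2 hpl hζ mods f hf M).PiX
        (levelSetting C hC hS hl hp2 hpl hζ mods f hf M).DeltaX ≃ₜ*
      (levelSetting C hC hS hl hp2 hpl hζ mods f hf M).Gk) :=
  ThetaSetting.quotDeltaX_iso_ofDoubleUnderline_of_isTempered C (mods M) hC hS hl hp2 hpl hζ
    (eta0_mem C hC hS mods f hf M) hT

/-- **(H2) at `EtaleLevels.setting` from temperedness** — the binder `hq` of the Cor. 1.11 / Cor. 1.12 (iii) genuine-chain
theorems (p431925, p433665, p434854, p434852). [claim: Mochizuki2012, status: disputed] (IUTchII §1 Ex 1.8 (i), kurims p.35) -/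
theorem quotDeltaX_iso_setting_of_isTempered (hT : IsTempered D.PiTemp) [FirstCountableTopology D.PiTemp] :
    Nonempty (TopGroup.quot (setting C hC hS hl hp2 hpl hζ mods f hf).PiX
        (setting C hC hS hl hp2 hpl hζ mods f hf).DeltaX ≃ₜ*
      (setting C hC hS hl hp2 hpl hζ mods f hf).Gk) :=
  quotDeltaX_iso_levelSetting_of_isTempered C hC hS hl hp2 hpl hζ mods f hf hT 1

/-- (H2) at `EtaleLevels.setting` from the §6 parameter bundle `d : GroupLevelData` (ruling η′).
[claim: Mochizuki2012, status: disputed] (IUTchII §1 Ex 1.8 (i), kurims p.35) -/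
theorem quotDeltaX_iso_setting_of_groupLevelData (d : D.toTemperedCurve.GroupLevelData) :
    Nonempty (TopGroup.quot (setting C hC hS hl hp2 hpl hζ mods f hf).PiX
        (setting C hC hS hl hp2 hpl hζ mods f hf).DeltaX ≃ₜ*
      (setting C hC hS hl hp2 hpl hζ mods f hf).Gk) := by
  haveI := d.secondCountableTopology
  exact quotDeltaX_iso_setting_of_isTempered C hC hS hl hp2 hpl hζ mods f hf d.isTempered

/-! ### (H1) at the level settings from ONE regime package -/

/-- **The compatible MLF completion package EXISTS at every level setting** (p429527 at `ofDoubleUnderline`).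
[cite: MochizukiSemiAnbd2006, §6 p.69] -/
theorem exists_completion_package_levelSetting (M : ℕ+) :
    ∃ (E : FundamentalExtension.{0}) (_ : E.MLFBase)
      (ι : (levelSetting C hC hS hl hp2 hpl hζ mods f hf M).PiX →ₜ* E.arith)
      (g : (levelSetting C hC hS hl hp2 hpl hζ mods f hf M).Gk →* E.gal),
      IsProfiniteCompletion ι ∧ Function.Injective g ∧
        ∀ x, E.aug (ι x) = g ((levelSetting C hC hS hl hp2 hpl hζ mods f hf M).aug x) :=
  ThetaSetting.exists_completion_package_ofDoubleUnderline C (mods M) hC hS hl hp2 hpl hζ (eta0_mem C hC hS mods f hf M)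

/-- The compatible MLF completion package exists at `EtaleLevels.setting`. [cite: MochizukiSemiAnbd2006, §6 p.69] -/
theorem exists_completion_package_setting :
    ∃ (E : FundamentalExtension.{0}) (_ : E.MLFBase)
      (ι : (setting C hC hS hl hp2 hpl hζ mods f hf).PiX →ₜ* E.arith)
      (g : (setting C hC hS hl hp2 hpl hζ mods f hf).Gk →* E.gal),
      IsProfiniteCompletion ι ∧ Function.Injective g ∧
        ∀ x, E.aug (ι x) = g ((setting C hC hS hl hp2 hpl hζ mods f hf).aug x) :=
  exists_completion_package_levelSetting C hC hS hl hp2 hpl hζ mods f hf 1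

/-- **(H1) at the level-`M` setting from the existence of ONE compatible completion package in the [AbsTopI] Thm 2.6 (v)
regime** (`Δ_E` tfg + `CoinvariantRankConstant` = FACT-LIST F-0001 at that named instance).
[claim: Mochizuki2012, status: disputed] (IUTchII §1 Ex 1.8 (i), kurims p.35) [cite: MochizukiAbsTopI2012, Thm 2.6 (v) p.22] -/
theorem deltaX_characteristic_levelSetting_of_exists_package (M : ℕ+)
    (h : ∃ (E : FundamentalExtension.{0}) (_ : E.MLFBase)
      (ι : (levelSetting C hC hS hl hp2 hpl hζ mods f hf M).PiX →ₜ* E.arith)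
      (g : (levelSetting C hC hS hl hp2 hpl hζ mods f hf M).Gk →* E.gal),
      IsProfiniteCompletion ι ∧ Function.Injective g ∧
        (∀ x, E.aug (ι x) = g ((levelSetting C hC hS hl hp2 hpl hζ mods f hf M).aug x)) ∧
        IsTopologicallyFinitelyGenerated E.geom ∧ E.CoinvariantRankConstant) :
    ∀ φ : (levelSetting C hC hS hl hp2 hpl hζ mods f hf M).PiX ≃ₜ* (levelSetting C hC hS hl hp2 hpl hζ mods f hf M).PiX,
      (levelSetting C hC hS hl hp2 hpl hζ mods f hf M).DeltaX.map φ.toMulEquiv.toMonoidHom =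
        (levelSetting C hC hS hl hp2 hpl hζ mods f hf M).DeltaX :=
  ThetaSetting.deltaX_characteristic_ofDoubleUnderline_of_exists_package C (mods M) hC hS hl hp2 hpl hζ
    (eta0_mem C hC hS mods f hf M) h

/-- **(H1) at `EtaleLevels.setting` from ONE regime package** — the binder `hΔ` of the Cor. 1.11 / Cor. 1.12 (iii)
genuine-chain theorems. [claim: Mochizuki2012, status: disputed] (IUTchII §1 Ex 1.8 (i), kurims p.35) -/
theorem deltaX_characteristic_setting_of_exists_package
    (h : ∃ (E : FundamentalExtension.{0}) (_ : E.MLFBase)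
      (ι : (setting C hC hS hl hp2 hpl hζ mods f hf).PiX →ₜ* E.arith)
      (g : (setting C hC hS hl hp2 hpl hζ mods f hf).Gk →* E.gal),
      IsProfiniteCompletion ι ∧ Function.Injective g ∧
        (∀ x, E.aug (ι x) = g ((setting C hC hS hl hp2 hpl hζ mods f hf).aug x)) ∧
        IsTopologicallyFinitelyGenerated E.geom ∧ E.CoinvariantRankConstant) :
    ∀ φ : (setting C hC hS hl hp2 hpl hζ mods f hf).PiX ≃ₜ* (setting C hC hS hl hp2 hpl hζ mods f hf).PiX,
      (setting C hC hS hl hp2 hpl hζ mods f hf).DeltaX.map φ.toMulEquiv.toMonoidHom =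
        (setting C hC hS hl hp2 hpl hζ mods f hf).DeltaX :=
  deltaX_characteristic_levelSetting_of_exists_package C hC hS hl hp2 hpl hζ mods f hf 1 h

/-- **The [IUTchII] Ex 1.8 interface `AbsTopMonoids` is INHABITED at every level setting modulo {η′ parameters of `Π^tp_X`,
ONE regime package}.** [claim: Mochizuki2012, status: disputed] (IUTchII §1 Ex 1.8 (i), kurims p.35) -/
theorem nonempty_absTopMonoids_levelSetting_of_isTempered (hT : IsTempered D.PiTemp) [FirstCountableTopology D.PiTemp]
    (M : ℕ+)
    (h : ∃ (E : FundamentalExtension.{0}) (_ : E.MLFBase)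
      (ι : (levelSetting C hC hS hl hp2 hpl hζ mods f hf M).PiX →ₜ* E.arith)
      (g : (levelSetting C hC hS hl hp2 hpl hζ mods f hf M).Gk →* E.gal),
      IsProfiniteCompletion ι ∧ Function.Injective g ∧
        (∀ x, E.aug (ι x) = g ((levelSetting C hC hS hl hp2 hpl hζ mods f hf M).aug x)) ∧
        IsTopologicallyFinitelyGenerated E.geom ∧ E.CoinvariantRankConstant) :
    Nonempty (AbsTopMonoids (levelSetting C hC hS hl hp2 hpl hζ mods f hf M)) :=
  ThetaSetting.nonempty_absTopMonoids_ofDoubleUnderline_of_isTempered C (mods M) hC hS hl hp2 hpl hζ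
    (eta0_mem C hC hS mods f hf M) hT h

/-- **The GENUINE-mod-`ε` producer of this lineage at `EtaleLevels.setting` over the setting's own `(K, AlgebraicClosure K)`,
with (H1)/(H2) from η′ + ONE regime package, has monoid `𝒪^⊳_{K̄_K}` at every isomorph** — the producer term the Cor. 1.11
own-field theorem p433665 is stated over, now with both binders supplied BY NAME.
[claim: Mochizuki2012, status: disputed] (IUTchII §1 Ex 1.8 (ii), kurims p.36) -/
theorem genuineOfModel_setting_Otri_of_isTempered_of_package (hT : IsTempered D.PiTemp) [FirstCountableTopology D.PiTemp]
    (h : ∃ (E : FundamentalExtension.{0}) (_ : E.MLFBase)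
      (ι : (setting C hC hS hl hp2 hpl hζ mods f hf).PiX →ₜ* E.arith)
      (g : (setting C hC hS hl hp2 hpl hζ mods f hf).Gk →* E.gal),
      IsProfiniteCompletion ι ∧ Function.Injective g ∧
        (∀ x, E.aug (ι x) = g ((setting C hC hS hl hp2 hpl hζ mods f hf).aug x)) ∧
        IsTopologicallyFinitelyGenerated E.geom ∧ E.CoinvariantRankConstant)
    (G : IsoClass (setting C hC hS hl hp2 hpl hζ mods f hf).Gk) :
    (AbsTopMonoids.genuineOfModel (setting C hC hS hl hp2 hpl hζ mods f hf) D.toTemperedCurve.mlfClosure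
        D.toTemperedCurve.galoisEpsilon
        (deltaX_characteristic_setting_of_exists_package C hC hS hl hp2 hpl hζ mods f hf h)
        (quotDeltaX_iso_setting_of_isTempered C hC hS hl hp2 hpl hζ mods f hf hT)).Otri G =
      (ModelMLFGaloisData.galois D.toTemperedCurve.mlfClosure.k D.toTemperedCurve.mlfClosure.K).tmPair.M :=
  rfl

end EtaleLevels

end Literature.IUT.HodgeArakelov

end
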